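import Literature.MathematicalPhysics.QuantumFieldTheory.Balaban1983to89.B5Eq191LagrangeG
import Literature.MathematicalPhysics.QuantumFieldTheory.Balaban1983to89.B5Identities197Torus

/-!
# `Balaban1983to89.B5Eq191LagrangeGTorusR` — [Balaban1984PropagatorsI] (1.91)–(1.93) p. 33 with the PRINTED `R`:
the hypotheses `hRs`/`h95`/`h97` of `…B5Eq191LagrangeG` DISCHARGED for `R = B5Identities197Torus.RT` (the p. 25
orthogonal projection onto ΔN(Q′_k)) by p21's `RT_conjTranspose`, `eq195_left` ((1.95)), `eq197_left` ((1.97)) —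
so the solution of (1.92) and the minimisation sentence of p. 33 hold unconditionally on the torus carriers

statement-level skeleton of published theorems with citation tags; proofs where landed; nothing here is a claim about the Yang–Mills mass gap

CITATION HEADER.  T. Bałaban, *Propagators and renormalization transformations for lattice gauge theories. I*,
Commun. Math. Phys. **95** (1984) 17–40 [Balaban1984PropagatorsI] (= B5; PDF held `paper:balaban1984-cmp95-propagators-rt-i`,
journal page = PDF page + 16; p. 33 render `…1984-cmp95-propagators-rt-I-p017-x2.png`).  Unit `lit-balaban-r02` gen 3
(B5 fold owner); SKELETON row **B5.Eq1.93**; companion (one-line instantiations) of `…B5Eq191LagrangeG`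
(`R` a parameter there) and `…B5Identities197Torus` (p21: `RT`, (1.95)/(1.97) on the torus).  Theorems only.
-/

open scoped BigOperators Matrix ComplexConjugate ComplexOrder

namespace Literature.MathematicalPhysics.QuantumFieldTheory.Balaban1983to89.B5Eq191LagrangeGTorusR

open B5Prop11Plancherel (Tor fine)
open B5Action121 (GradOp)
open B5Block118 (QvOp)
open B5DeltaA169 (QvAdj DeltaA)
open B5Identities197Torus (RT RT_conjTranspose eq195_left eq197_left)
open B5Eq191LagrangeG (form191 EL192 el192_iff form191_Hk_le form191_lt_of_ne el192_lam_eq_zero el192_A_eq_Hk)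
open Beta.FluctuationProjection (QGQ Hk)

noncomputable section

variable {d : ℕ} (n : ℕ) [NeZero n] (hn : 1 ≤ n) (M : Fin d → ℕ) [hM : ∀ μ, NeZero (M μ)] (a : ℝ) (ha : 0 < a)
include hn ha

/-- (1.92) with the printed `R` (= `RT`, the projection onto ΔN(Q′_k)) and `Rλ = λ` has exactly one solution,
`(A, ω, λ) = (H_kB, −(QGQ*)⁻¹B, 0)` — (1.93), «Rλ = λ = 0», (1.98), (1.103).
[cite: Balaban1984PropagatorsI, (1.92)–(1.93) p.33, (1.98) p.34, (1.103) p.34] -/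
theorem el192_iff_RT (B : Tor M × Fin d → ℂ) (A : Tor (fine n M) × Fin d → ℂ) (ω : Tor M × Fin d → ℂ)
    (lam : Tor (fine n M) → ℂ) (hR : RT n M *ᵥ lam = lam) :
    EL192 n M a (RT n M) B A ω lam ↔
      A = Hk n hn M a ha *ᵥ B ∧ ω = -((QGQ n hn M a ha)⁻¹ *ᵥ B) ∧ lam = 0 :=
  el192_iff n M a (RT n M) hn ha (eq195_left n hn M a ha) (eq197_left n hn M a ha) B A ω lam hR

/-- «Rλ = λ = 0» (p. 34) for the printed `R`: every solution of (1.92) with `Rλ = λ` has `λ = 0`.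
[cite: Balaban1984PropagatorsI, (1.93) p.33, (1.98) p.34] -/
theorem el192_lam_eq_zero_RT {B : Tor M × Fin d → ℂ} {A : Tor (fine n M) × Fin d → ℂ} {ω : Tor M × Fin d → ℂ}
    {lam : Tor (fine n M) → ℂ} (hR : RT n M *ᵥ lam = lam) (h : EL192 n M a (RT n M) B A ω lam) : lam = 0 :=
  el192_lam_eq_zero n M a (RT n M) hn ha (eq195_left n hn M a ha) (eq197_left n hn M a ha) hR h

/-- the solution of (1.92) with the printed `R` IS (1.103) `H_kB`. [cite: Balaban1984PropagatorsI, (1.103) p.34] -/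
theorem el192_A_eq_Hk_RT {B : Tor M × Fin d → ℂ} {A : Tor (fine n M) × Fin d → ℂ} {ω : Tor M × Fin d → ℂ}
    {lam : Tor (fine n M) → ℂ} (hR : RT n M *ᵥ lam = lam) (h : EL192 n M a (RT n M) B A ω lam) :
    A = Hk n hn M a ha *ᵥ B :=
  el192_A_eq_Hk n M a (RT n M) hn ha (eq195_left n hn M a ha) (eq197_left n hn M a ha) hR h

/-- **p. 33, verbatim: «H_kB … is defined as a minimum of the form ½⟨A, Δ_aA⟩ − a⟨B, B⟩ under the conditions
QA = B, R∂*A = 0»** — with the printed `R`, unconditionally on the torus carriers (`1 ≤ n`, `0 < a`).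
[cite: Balaban1984PropagatorsI, p.33 (before (1.91)), (1.103) p.34] -/
theorem form191_Hk_le_RT (B : Tor M × Fin d → ℂ) (A₁ : Tor (fine n M) × Fin d → ℂ) (hA₁ : QvOp n M *ᵥ A₁ = B)
    (hR₁ : RT n M *ᵥ ((GradOp (fine n M) (n : ℂ))ᴴ *ᵥ A₁) = 0) :
    form191 n M a B (Hk n hn M a ha *ᵥ B) ≤ form191 n M a B A₁ :=
  form191_Hk_le n M a (RT n M) hn ha (RT_conjTranspose n M) (eq195_left n hn M a ha) B A₁ hA₁ hR₁

/-- … strictly for `A₁ ≠ H_kB`: the constrained minimiser is unique (Δ_a > 0).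
[cite: Balaban1984PropagatorsI, p.33 (before (1.91)), Prop. 1.1 p.33] -/
theorem form191_lt_of_ne_RT (B : Tor M × Fin d → ℂ) (A₁ : Tor (fine n M) × Fin d → ℂ) (hA₁ : QvOp n M *ᵥ A₁ = B)
    (hR₁ : RT n M *ᵥ ((GradOp (fine n M) (n : ℂ))ᴴ *ᵥ A₁) = 0) (hne : A₁ ≠ Hk n hn M a ha *ᵥ B) :
    form191 n M a B (Hk n hn M a ha *ᵥ B) < form191 n M a B A₁ :=
  form191_lt_of_ne n M a (RT n M) hn ha (RT_conjTranspose n M) (eq195_left n hn M a ha) B A₁ hA₁ hR₁ hne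

end

end Literature.MathematicalPhysics.QuantumFieldTheory.Balaban1983to89.B5Eq191LagrangeGTorusR
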